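import Literature.MathematicalPhysics.QuantumFieldTheory.Balaban1983to89.T3ThresholdRemoval
import Literature.MathematicalPhysics.QuantumFieldTheory.Balaban1983to89.B12RTGaugeInvariance254
import Literature.MathematicalPhysics.QuantumFieldTheory.Balaban1983to89.T4WilsonGaugeFlatDirection

/-!
# `Balaban1983to89.T3UnitLawGaugeInvariance` — the Gibbs measures and the UNIT LAWS of the d = 3 Wilson scheme are
# GAUGE INVARIANT probability measures (every compact `G`, every measurable small-loop average `ℰ`)

Cell `ym3-torus` (HUMAN RULING D-0037, YM ladder rung R3), seat `ym3-torus-p2` gen 2.  WHAT THIS IS NOT: not d = 4, not infinite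
volume, not a mass gap, not Clay, not the expectations step (E3): elementary symmetry bookkeeping ([folklore] over the tree's
definitions), recorded because the law-level reading of E3 (`T3ContinuumUnitLaw`) consumes it.

CONTENT.  [Balaban1985Averaging] (8)–(13) p. 19: a gauge transformation `u : T → G` acts by `U^u(x,y) = u(x)U(x,y)u(y)⁻¹`; the
Wilson action and the product Haar measure are invariant, and «we demand that the averaging preserves gauge transformations,
i.e., Ū^u = (Ū)^u» (11), with `u` on the coarse lattice the restriction of `u` to the block centres.  Hence:
§1 (any level `j`, any `G`): `U ↦ U^u` composes (`gaugeAct_gaugeAct`); with the tree's gauge invariance of the Wilson action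
   (`T4WilsonGaugeFlatDirection.wilsonAction_gaugeAct`) and of the product Haar measure
   (`B12FaddeevPopov016.integral_comp_gaugeAct`, `B12RTGaugeInvariance254.measurePreserving_gaugeAct`) it preserves the
   Boltzmann weight (`boltzmann_gaugeAct`), the torus expectation (`expect_gaugeAct`, `IsExpectSymmetry.gaugeAct`) and the
   normalised Gibbs MEASURE (`map_gaugeAct_gibbsMeasure`, by testing the push-forward on indicators).
§2 (the d = 3 scheme): every gauge transformation `v` of the unit torus is the block-centre restriction of one of the finest
   lattice (`blockUp`, `transfUp_blockUp`), the unit map `A_K = unitShift K ∘ avg^K` is EQUIVARIANT (`unitA_gaugeAct`), and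
   therefore THE UNIT LAWS ARE GAUGE INVARIANT: `(unitLaw K).map (gaugeAct v) = unitLaw K` (`map_gaugeAct_unitLaw`) for every
   `K`, every `v`, every measurable `ℰ`, every `γ ≥ 0`.
-/

noncomputable section

open MeasureTheory Filter Topology
open Literature.MathematicalPhysics.QuantumFieldTheory.Balaban1983to89.T3ContinuumYM3Torus
open Literature.MathematicalPhysics.QuantumFieldTheory.Balaban1983to89.T3LevelShift
open Literature.MathematicalPhysics.QuantumFieldTheory.Balaban1983to89.T3ThresholdRemoval
open Literature.MathematicalPhysics.QuantumFieldTheory.Balaban1983to89.Missing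
open Literature.MathematicalPhysics.QuantumFieldTheory.Balaban1983to89.T4Continuum
open Literature.MathematicalPhysics.QuantumFieldTheory.Balaban1983to89.B12RTGaugeInvariance254 (measurable_gaugeAct
  measurePreserving_gaugeAct)

namespace Literature.MathematicalPhysics.QuantumFieldTheory.Balaban1983to89.T3UnitLawGaugeInvariance

/-! ## §0 Kernel: a push-forward is identified by the integrals of bounded measurable functions -/

/-- Two finite measures related by `∫ f ∘ φ dμ = ∫ f dν` for all measurable `f` with `|f| ≤ 1` satisfy `φ_* μ = ν`
(test on indicators; local helper). [folklore] -/
private theorem map_eq_of_integral_comp_eq {X Y : Type*} [MeasurableSpace X] [MeasurableSpace Y] {μ : Measure X}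
    {ν : Measure Y} [IsFiniteMeasure μ] [IsFiniteMeasure ν] {φ : X → Y} (hφ : Measurable φ)
    (h : ∀ f : Y → ℝ, Measurable f → (∀ y, |f y| ≤ 1) → ∫ x, f (φ x) ∂μ = ∫ y, f y ∂ν) : μ.map φ = ν := by
  refine Measure.ext fun s hs => ?_
  have hi : Measurable (s.indicator (1 : Y → ℝ)) := measurable_one.indicator hs
  have hb : ∀ y, |s.indicator (1 : Y → ℝ) y| ≤ 1 := fun y => by
    by_cases hy : y ∈ s
    · simp [hy]
    · simp [hy]
  have h1 := h _ hi hb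
  have h3 : (fun x => s.indicator (1 : Y → ℝ) (φ x)) = (φ ⁻¹' s).indicator 1 := by
    funext x
    by_cases hx : φ x ∈ s
    · simp [hx]
    · simp [hx]
  rw [Measure.map_apply hφ hs]
  have h2 : μ.real (φ ⁻¹' s) = ν.real s := by
    rw [← integral_indicator_one (hφ hs), ← integral_indicator_one hs, ← h1, h3]
  exact (ENNReal.toReal_eq_toReal_iff' (measure_ne_top _ _) (measure_ne_top _ _)).mp h2

/-! ## §1 Gauge transformations: composition, Wilson action, product Haar measure, expectation, Gibbs measure -/

section Gauge

variable {P : Params} {j : ℕ} {G : Type*} [GaugeGroup G]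

/-- Gauge transformations compose: `(U^v)^u = U^{uv}`. [cite: Balaban1985Averaging, (8) p.19] -/
theorem gaugeAct_gaugeAct (u v : GaugeTransf P j G) (U : GaugeField P j G) :
    GaugeField.gaugeAct u (GaugeField.gaugeAct v U) = GaugeField.gaugeAct (fun x => u x * v x) U := by
  funext b
  simp only [GaugeField.gaugeAct, mul_inv_rev, mul_assoc]

/-- The Boltzmann weight `exp(−βA(U))` is gauge invariant. [cite: Balaban1985Averaging, (9) p.19] -/
theorem boltzmann_gaugeAct (P : Params) (β : ℝ) (u : GaugeTransf P 0 G) (U : GaugeField P 0 G) :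
    boltzmann P β (GaugeField.gaugeAct u U) = boltzmann P β U := by
  rw [boltzmann, boltzmann, wilsonAction4, wilsonAction4, T4WilsonGaugeFlatDirection.wilsonAction_gaugeAct]

variable [MeasurableSpace G] [HaarData G] [RegularGaugeGroup G]

/-- **Torus expectations are gauge invariant**: `⟨F ∘ (·)^u⟩_{P,β} = ⟨F⟩_{P,β}` for EVERY `F` and every real `β` (invariance of
the weight + the tree's change of variables `B12FaddeevPopov016.integral_comp_gaugeAct`). [cite: Balaban1985Averaging, (12) p.19] -/
theorem expect_gaugeAct (P : Params) (β : ℝ) (u : GaugeTransf P 0 G) (Fo : GaugeField P 0 G → ℝ) :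
    Missing.expect P β (fun U => Fo (GaugeField.gaugeAct u U)) = Missing.expect (G := G) P β Fo := by
  unfold Missing.expect
  congr 1
  calc ∫ U, Fo (GaugeField.gaugeAct u U) * boltzmann P β U ∂fieldMeasure P 0 G
      = ∫ U, (fun V => Fo V * boltzmann P β V) (GaugeField.gaugeAct u U) ∂fieldMeasure P 0 G := by
        congr 1
        funext U
        simp only [boltzmann_gaugeAct]
    _ = ∫ V, Fo V * boltzmann P β V ∂fieldMeasure P 0 G :=
        B12FaddeevPopov016.integral_comp_gaugeAct u (fun V => Fo V * boltzmann P β V)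

/-- **Gauge transformations are exact expectation symmetries** of every Wilson theory on Bałaban's finest torus.
[cite: Balaban1985Averaging, (12) p.19] -/
theorem IsExpectSymmetry.gaugeAct {P : Params} {β : ℝ} (u : GaugeTransf P 0 G) :
    Missing.IsExpectSymmetry (G := G) P β (GaugeField.gaugeAct u) :=
  fun Fo => expect_gaugeAct P β u Fo

/-- **The normalised Gibbs MEASURE is gauge invariant**: `(U ↦ U^u)_* Gibbs_{P,β} = Gibbs_{P,β}` (`β ≥ 0`).
[cite: Balaban1985Averaging, (12) p.19] -/
theorem map_gaugeAct_gibbsMeasure (P : Params) {β : ℝ} (hβ : 0 ≤ β) (u : GaugeTransf P 0 G) :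
    (T4GenFunBounds.gibbsMeasure P β).map (GaugeField.gaugeAct u) = T4GenFunBounds.gibbsMeasure (G := G) P β := by
  haveI := T4GenFunBounds.isProbabilityMeasure_gibbsMeasure (G := G) P hβ
  refine map_eq_of_integral_comp_eq (measurable_gaugeAct u) fun f _ _ => ?_
  rw [T4GenFunBounds.integral_gibbsMeasure_eq_expect P hβ, T4GenFunBounds.integral_gibbsMeasure_eq_expect P hβ]
  exact expect_gaugeAct P β u f

end Gauge

/-! ## §2 The d = 3 scheme: every unit gauge transformation lifts, the unit map is equivariant, the unit laws are invariant -/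

section UnitLaw

variable {P : Params} {G : Type*} [GaugeGroup G]

/-- The `k`-fold block label of a finest-lattice site (`blockOf` iterated). [cite: Balaban1987RG1, (0.3) p.252] -/
def blockUp : (k : ℕ) → Site P 0 → Site P k
  | 0 => id
  | k + 1 => fun z => blockOf (blockUp k z)

omit [GaugeGroup G] in
/-- **Every gauge transformation of level `k` is the block-centre restriction of one of the finest lattice**: for
`u(z) := w(block^k(z))`, `u^{(k)} = w` (`transfUp`, [Balaban1985Averaging] (12)–(13): «u coinciding with v at points of the new
lattice»; standing range `k ≤ m + K`). [cite: Balaban1985Averaging, (12) p.19] -/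
theorem transfUp_blockUp : ∀ (k : ℕ), k ≤ P.m + P.K → ∀ w : GaugeTransf P k G,
    transfUp (fun z => w (blockUp k z)) k = w
  | 0, _, _ => rfl
  | k + 1, hk, w => by
    funext y
    have h := congrFun (transfUp_blockUp k (Nat.le_of_succ_le hk) (fun x => w (blockOf x))) (emb y)
    exact h.trans (congrArg w (Site.blockOf_emb hk y))

variable (F : T3Family) (ℰ : LoopAverage G)

/-- **THE UNIT MAP IS GAUGE EQUIVARIANT**: `A_K(U^u) = (A_K U)^{v}` with `v` = the restriction `u^{(K)}` read on the unit labels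
(`iter_gaugeAct` + `fieldShift_gaugeAct`). [cite: Balaban1985Averaging, (11) p.19] -/
theorem unitA_gaugeAct (K : ℕ) (u : GaugeTransf (F.P K) 0 G) (U : GaugeField (F.P K) 0 G) :
    unitShift F K (Averaging.iter (fun j => BlockAveraging.blockAvg (P := F.P K) (j := j) ℰ) K (GaugeField.gaugeAct u U)) =
      GaugeField.gaugeAct (fun x => transfUp u K (siteShift (F.sitesPerDir_unit K) x))
        (unitShift F K (Averaging.iter (fun j => BlockAveraging.blockAvg (P := F.P K) (j := j) ℰ) K U)) := by
  have h1 := iter_gaugeAct (fun j => BlockAveraging.blockAvg (P := F.P K) (j := j) ℰ) u K (Nat.le_add_left K F.m) U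
  rw [h1]
  exact fieldShift_gaugeAct (F.sitesPerDir_unit K) (transfUp u K) _

/-- The lift of a unit gauge transformation `v` to the finest lattice of the `K`-th approximation whose restriction, read on
the unit labels, is `v` (`liftTransf_spec`). [cite: Balaban1985Averaging, (12) p.19] -/
def liftTransf (K : ℕ) (v : GaugeTransf (F.P 0) 0 G) : GaugeTransf (F.P K) 0 G :=
  fun z => v ((siteShift (F.sitesPerDir_unit K)).symm (blockUp K z))

omit [GaugeGroup G] in
/-- `(liftTransf K v)^{(K)} ∘ siteShift = v`. [cite: Balaban1985Averaging, (12) p.19] -/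
theorem liftTransf_spec (K : ℕ) (v : GaugeTransf (F.P 0) 0 G) :
    (fun x => transfUp (liftTransf F K v) K (siteShift (F.sitesPerDir_unit K) x)) = v := by
  funext x
  have h := congrFun (transfUp_blockUp (P := F.P K) K (Nat.le_add_left K F.m)
    (fun y => v ((siteShift (F.sitesPerDir_unit K)).symm y))) (siteShift (F.sitesPerDir_unit K) x)
  exact h.trans (by simp)

variable [MeasurableSpace G] [HaarData G] [RegularGaugeGroup G] (hE : ℰ.MeasurableE) {γ : ℝ}

/-- **THE UNIT LAWS ARE GAUGE INVARIANT**: `(u ↦ u^{v})_* unitLaw_K = unitLaw_K` for every gauge transformation `v` of the unit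
torus (`γ ≥ 0`, measurable `ℰ`, every compact `G`): lift `v` to the finest lattice, use the equivariance of `A_K` and the gauge
invariance of the Gibbs measure. [cite: Balaban1985Averaging, (12) p.19] -/
theorem map_gaugeAct_unitLaw (hγ : 0 ≤ γ) (K : ℕ) (v : GaugeTransf (F.P 0) 0 G) :
    (F.unitLaw ℰ hE γ K).map (GaugeField.gaugeAct v) = F.unitLaw ℰ hE γ K := by
  have hA : Measurable ((F.unitFactorisation ℰ hE γ).A K) := (F.unitFactorisation ℰ hE γ).measurable_A K
  have hcomp : (GaugeField.gaugeAct v ∘ (F.unitFactorisation ℰ hE γ).A K) =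
      ((F.unitFactorisation ℰ hE γ).A K ∘ GaugeField.gaugeAct (liftTransf F K v)) := by
    funext U
    show GaugeField.gaugeAct v (unitShift F K
        (Averaging.iter (fun j => BlockAveraging.blockAvg (P := F.P K) (j := j) ℰ) K U)) =
      unitShift F K (Averaging.iter (fun j => BlockAveraging.blockAvg (P := F.P K) (j := j) ℰ) K
        (GaugeField.gaugeAct (liftTransf F K v) U))
    rw [unitA_gaugeAct, liftTransf_spec]
    rfl
  rw [T3Family.unitLaw, T4VarianceMatching.UnitFactorisation.effLaw, Measure.map_map (measurable_gaugeAct v) hA, hcomp,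
    ← Measure.map_map hA (measurable_gaugeAct _),
    map_gaugeAct_gibbsMeasure _ (F.scheme_β_nonneg ℰ hγ K)]

/-- Consequently `∫ g (u^{v}) d(unitLaw_K) = ∫ g d(unitLaw_K)` for every measurable `g`. [cite: Balaban1985Averaging, (12) p.19] -/
theorem integral_unitLaw_comp_gaugeAct (hγ : 0 ≤ γ) (K : ℕ) (v : GaugeTransf (F.P 0) 0 G)
    {g : GaugeField (F.P 0) 0 G → ℝ} (hg : Measurable g) :
    ∫ u, g (GaugeField.gaugeAct v u) ∂F.unitLaw ℰ hE γ K = ∫ u, g u ∂F.unitLaw ℰ hE γ K := by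
  rw [← integral_map (measurable_gaugeAct v).aemeasurable hg.aestronglyMeasurable, map_gaugeAct_unitLaw F ℰ hE hγ K v]

end UnitLaw

end Literature.MathematicalPhysics.QuantumFieldTheory.Balaban1983to89.T3UnitLawGaugeInvariance

end
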